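import Literature.Probability.Percolation.KhSThreeDisorderCrossing
import Literature.Probability.Percolation.KhSThreeDisorderCrossingBonds
import Literature.Probability.Percolation.KhSThreeDisorderBoundaryValuesArcs
import Literature.Probability.Percolation.TriMarkedDomainRotate
import HarnessLib

/-!
# Khristoforov–Smirnov eq. (4) at `k = 3`, PERCOLATION side, EVERY arc

Topic `Literature/Probability/Percolation`; three-disorder lineage. The percolation-side identification of
`KhSThreeDisorderCrossing.lean` (arc `A₀`: `H₁(z) = P_{1/2}[∂_{y₀z}Ω ↔ A₁]`, `H₀(z) = P_{1/2}[∂_{zy₁}Ω ↔ A₂]`) transported to the arcs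
`A₁`, `A₂` by the cyclic symmetry of the marks (`TriMarkedDomain.rotate`): for `z` a boundary mid-edge of the arc `A_a` (dart `(g, o) ∈ D.stretch a`),
`H_{a+1}(z) = P_{1/2}[∂_{y_a z}Ω ↔ A_{a+1}]`, `H_a(z) = P_{1/2}[∂_{z y_{a+1}}Ω ↔ A_{a+2}]` and
`F(z) = P[∂_{z y_{a+1}} ↔ A_{a+2}]·τ^a + P[∂_{y_a z} ↔ A_{a+1}]·τ^{a+1}` — Khristoforov–Smirnov's eq. (4) (arXiv v1 p. 5) for every boundary
arc `∂_jΩ` of a 3-marked discrete domain. The sub-arcs are written in a rotation-invariant way (`arcToA`, `arcFromA`: darts counted from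
the marked dart of the arc, resp. from `z`, along the boundary successor) and identified with the `A₀` vocabulary `arcTo`, `arcFrom`.

Edition 2 (appendix «every arc, EVERY mid-edge»): the same transport applied to the primed theorems of `KhSThreeDisorderCrossingBonds.lean`
(no hypothesis on the face `v` at which `z` is read): `hobs_eq_prob_of_mem_stretch'`, `fobs_eq_crossingProbs_of_mem_stretch'` — Khristoforov–Smirnov's
eq. (4), percolation side, at every boundary mid-edge of every arc of every 3-marked domain, exactly as printed.

## References
* M. Khristoforov, S. Smirnov, *Percolation and O(1) loop model*, arXiv:2111.15612 (2021), §1.2 Lemma 2 (pp. 2–3), §2 eq. (4) (p. 5).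
-/

open Finset

namespace Literature.Probability.Percolation.MarkedLoops

open Literature.Probability.Percolation Literature.Probability.LatticeModels
open Literature.Probability.Percolation.FivePoint (side tau)
open TriMarkedDomain

section ArcsP

variable {D : TriMarkedDomain 3}

open Classical in
/-- **the sub-arc `∂_{y_a z}` of `A_a`, rotation-invariant form**: the tails of the darts `succ^t (markDart a)` up to the first `t` that
reaches the dart of `z`. [cite: KhristoforovSmirnov2021, §1.2 (arXiv v1 p. 2: «the counterclockwise arc ∂_{zw}Ω»)] -/
noncomputable def arcToA (D : TriMarkedDomain 3) (a : Fin 3) (g o : Site 2) : Finset (Site 2) :=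
  ((Finset.range #(triBdryDarts D.verts)).filter fun t =>
      ∀ s < t, triBdryIter D.verts (D.markDart a) s ≠ (g, o)).image fun t => (triBdryIter D.verts (D.markDart a) t).1

open Classical in
/-- **the sub-arc `∂_{z y_{a+1}}` of `A_a`, rotation-invariant form**: the tails of the darts `succ^t (g, o)` as long as they stay in the
stretch `A_a`. [cite: KhristoforovSmirnov2021, §1.2 (arXiv v1 p. 2: «the counterclockwise arc ∂_{zw}Ω»)] -/
noncomputable def arcFromA (D : TriMarkedDomain 3) (a : Fin 3) (g o : Site 2) : Finset (Site 2) :=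
  ((Finset.range #(triBdryDarts D.verts)).filter fun t =>
      ∀ s ≤ t, triBdryIter D.verts (g, o) s ∈ D.stretch a).image fun t => (triBdryIter D.verts (g, o) t).1

/-- the events, every arc: an open path from `∂_{y_a z}` to `A_{a+1}`. [cite: KhristoforovSmirnov2021, §2 eq. (4) (arXiv v1 p. 5)] -/
def arcToCrossingA (D : TriMarkedDomain 3) (a : Fin 3) (g o : Site 2) : Set (SiteConfig (Site 2)) :=
  {σ | ∃ x ∈ arcToA D a g o, ∃ y ∈ D.arc (a + 1), PathIn triGraph ((D.verts : Set (Site 2)) ∩ σ) x y}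

/-- an open path from `∂_{z y_{a+1}}` to `A_{a+2}`. [cite: KhristoforovSmirnov2021, §2 eq. (4) (arXiv v1 p. 5)] -/
def arcFromCrossingA (D : TriMarkedDomain 3) (a : Fin 3) (g o : Site 2) : Set (SiteConfig (Site 2)) :=
  {σ | ∃ x ∈ arcFromA D a g o, ∃ y ∈ D.arc (a + 2), PathIn triGraph ((D.verts : Set (Site 2)) ∩ σ) x y}

/-! ### rotation invariance -/

/-- the rotated domain has the same boundary traversal. [folklore] [cite: KhristoforovSmirnov2021, §2 eq. (4) (arXiv v1 p. 5)] -/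
theorem rotate_arcToA (a : Fin 3) (g o : Site 2) : arcToA D.rotate a g o = arcToA D (a + 1) g o := by
  unfold arcToA
  rw [rotate_markDart]
  rfl

/-- the rotated domain has the same stretches, shifted. [folklore] [cite: KhristoforovSmirnov2021, §2 eq. (4) (arXiv v1 p. 5)] -/
theorem rotate_arcFromA (a : Fin 3) (g o : Site 2) : arcFromA D.rotate a g o = arcFromA D (a + 1) g o := by
  classical
  unfold arcFromA
  simp only [rotate_stretch, rotate_verts]

/-- events under rotation. [folklore] [cite: KhristoforovSmirnov2021, §2 eq. (4) (arXiv v1 p. 5)] -/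
theorem rotate_arcToCrossingA (a : Fin 3) (g o : Site 2) : arcToCrossingA D.rotate a g o = arcToCrossingA D (a + 1) g o := by
  unfold arcToCrossingA
  rw [rotate_arcToA, rotate_arc, add_assoc]
  rfl

/-- events under rotation. [folklore] [cite: KhristoforovSmirnov2021, §2 eq. (4) (arXiv v1 p. 5)] -/
theorem rotate_arcFromCrossingA (a : Fin 3) (g o : Site 2) : arcFromCrossingA D.rotate a g o = arcFromCrossingA D (a + 1) g o := by
  unfold arcFromCrossingA
  rw [rotate_arcFromA, rotate_arc, add_right_comm a 2 1]
  rfl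

/-! ### on `A₀` the rotation-invariant sub-arcs are `arcTo`, `arcFrom` -/

/-- on `A₀`: `arcToA D 0 = arcTo D`. [cite: KhristoforovSmirnov2021, §1.2 (arXiv v1 p. 2)] -/
theorem arcToA_zero {g o : Site 2} (hd : (g, o) ∈ triBdryDarts D.verts) : arcToA D 0 g o = arcTo D g o := by
  classical
  have hL := D.isTriDisc.card_pos
  have hpL := D.dpos_lt hd
  have hm0 : D.markDart 0 = D.base := by
    show triBdryIter D.verts D.base (D.pos 0) = D.base; rw [pos_facts.1]; rfl
  -- `bdart s = (g, o)` for `s < L` iff `s = p`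
  have key : ∀ s, s < #(triBdryDarts D.verts) → (bdart D s = (g, o) ↔ s = D.dpos (g, o)) := by
    intro s hs
    constructor
    · intro h; have := D.dpos_eq_of_iter_eq hs h; exact this.symm
    · intro h; rw [h, bdart_dpos hd]
  unfold arcToA arcTo
  rw [hm0]
  ext x
  simp only [Finset.mem_image, Finset.mem_filter, Finset.mem_range]
  constructor
  · rintro ⟨t, ⟨ht, hall⟩, rfl⟩
    have htle : t ≤ D.dpos (g, o) := by
      by_contra hlt
      exact hall (D.dpos (g, o)) (by omega) (bdart_dpos hd)
    exact ⟨bdart D t, ⟨t, by omega, rfl⟩, rfl⟩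
  · rintro ⟨d, ⟨t, ht, rfl⟩, rfl⟩
    refine ⟨t, ⟨by omega, fun s hs h => ?_⟩, rfl⟩
    have := (key s (by omega)).1 h
    omega

/-- membership of `bdart n` in the stretch `A₀`: the position is `< pos 1`. [folklore] [cite: KhristoforovSmirnov2021, §1.2 (arXiv v1 p. 2)] -/
theorem bdart_mem_stretch_zero_iff (n : ℕ) : bdart D n ∈ D.stretch 0 ↔ n % #(triBdryDarts D.verts) < D.pos 1 := by
  obtain ⟨h00, h01, h12, h2L⟩ := pos_facts (D := D)
  unfold stretch
  rw [h00, D.nextPos_of_lt₃ 0 (by decide)]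
  change bdart D n ∈ (Finset.Ico 0 (D.pos 1)).image (fun m => triBdryIter D.verts D.base m) ↔ _
  simp only [Finset.mem_image, Finset.mem_Ico]
  constructor
  · rintro ⟨m, ⟨-, hm⟩, h⟩
    have := D.isTriDisc.iter_eq_iter_iff.1 h
    rw [Nat.mod_eq_of_lt (by omega)] at this
    rw [← this]; exact hm
  · intro h
    exact ⟨n % #(triBdryDarts D.verts), ⟨Nat.zero_le _, h⟩, D.isTriDisc.iter_mod n⟩

/-- on `A₀`: `arcFromA D 0 = arcFrom D`. [cite: KhristoforovSmirnov2021, §1.2 (arXiv v1 p. 2)] -/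
theorem arcFromA_zero {g o : Site 2} (hd : (g, o) ∈ triBdryDarts D.verts) (hst : D.stretchIdx₃ (D.dpos (g, o)) = 0) :
    arcFromA D 0 g o = arcFrom D g o := by
  classical
  obtain ⟨h00, h01, h12, h2L⟩ := pos_facts (D := D)
  have hL := D.isTriDisc.card_pos
  have hpL := D.dpos_lt hd
  have hp1 : D.dpos (g, o) < D.pos 1 := by
    have := mod_lt_pos_one_of_stretchIdx_zero hst; rwa [Nat.mod_eq_of_lt hpL] at this
  set p := D.dpos (g, o) with hp
  have hiter : ∀ s, triBdryIter D.verts (g, o) s = bdart D (p + s) := by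
    intro s; rw [← bdart_dpos hd, ← hp]; unfold bdart; rw [triBdryIter_add]
  -- `∀ s ≤ t, bdart (p + s) ∈ A₀` iff `p + t < pos 1` (for `t < L`)
  have key : ∀ t, t < #(triBdryDarts D.verts) →
      ((∀ s ≤ t, triBdryIter D.verts (g, o) s ∈ D.stretch 0) ↔ p + t < D.pos 1) := by
    intro t ht
    constructor
    · intro h
      by_contra hge
      -- the first exit: s₀ = pos 1 - p ≤ t has position pos 1
      have hs0 : D.pos 1 - p ≤ t := by omega
      have := h (D.pos 1 - p) hs0
      rw [hiter, bdart_mem_stretch_zero_iff, show p + (D.pos 1 - p) = D.pos 1 by omega, Nat.mod_eq_of_lt (by omega)] at this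
      exact lt_irrefl _ this
    · intro h s hs
      rw [hiter, bdart_mem_stretch_zero_iff, Nat.mod_eq_of_lt (by omega)]
      omega
  unfold arcFromA arcFrom
  ext x
  simp only [Finset.mem_image, Finset.mem_filter, Finset.mem_range, Finset.mem_Ico]
  constructor
  · rintro ⟨t, ⟨ht, hall⟩, rfl⟩
    have hlt := (key t ht).1 hall
    exact ⟨bdart D (p + t), ⟨p + t, ⟨by omega, hlt⟩, rfl⟩, by rw [hiter]⟩
  · rintro ⟨d, ⟨n, ⟨hn1, hn2⟩, rfl⟩, rfl⟩
    refine ⟨n - p, ⟨by omega, (key (n - p) (by omega)).2 (by omega)⟩, ?_⟩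
    rw [hiter, show p + (n - p) = n by omega]

/-- events on `A₀` agree. [folklore] [cite: KhristoforovSmirnov2021, §2 eq. (4) (arXiv v1 p. 5)] -/
theorem arcToCrossingA_zero {g o : Site 2} (hd : (g, o) ∈ triBdryDarts D.verts) : arcToCrossingA D 0 g o = arcToCrossing D g o := by
  unfold arcToCrossingA arcToCrossing
  rw [arcToA_zero hd]
  rfl

/-- events on `A₀` agree. [folklore] [cite: KhristoforovSmirnov2021, §2 eq. (4) (arXiv v1 p. 5)] -/
theorem arcFromCrossingA_zero {g o : Site 2} (hd : (g, o) ∈ triBdryDarts D.verts) (hst : D.stretchIdx₃ (D.dpos (g, o)) = 0) :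
    arcFromCrossingA D 0 g o = arcFromCrossing D g o := by
  unfold arcFromCrossingA arcFromCrossing
  rw [arcFromA_zero hd hst]
  rfl

/-! ### eq. (4), percolation side, on every arc -/

/-- ★★★ **KhS eq. (4), PERCOLATION SIDE, EVERY ARC**: for `z` a boundary mid-edge of the arc `A_a` (dart `(g, o) ∈ D.stretch a`) read at a
face `v` with three `H_G`-sides, `H_{a+1}(z) = P_{1/2}[∂_{y_a z}Ω ↔ A_{a+1}]` and `H_a(z) = P_{1/2}[∂_{z y_{a+1}}Ω ↔ A_{a+2}]`.
[cite: KhristoforovSmirnov2021, §2 eq. (4) (arXiv v1 p. 5) with §1.2 Lemma 2 (pp. 2–3)] -/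
theorem hobs_eq_prob_of_mem_stretch {v : HexVertex} (hv : AllSides D v) {i : Fin 3} {g o : Site 2} (he : side v i = s(g, o))
    (hg : g ∈ D.verts) (ho : o ∉ D.verts) {a : Fin 3} (hd : (g, o) ∈ D.stretch a) :
    Hobs D v i (a + 1) = (triSitePercolation half).real (arcToCrossingA D a g o) ∧
      Hobs D v i a = (triSitePercolation half).real (arcFromCrossingA D a g o) := by
  have hadj : triGraph.Adj g o := by
    have hb : side v i ∈ hBonds D := hv i
    rw [he] at hb
    obtain ⟨a', b', hab, -, hadj'⟩ := exists_rep_of_mem_hBonds D hb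
    rcases Sym2.eq_iff.1 hab with ⟨e1, e2⟩ | ⟨e1, e2⟩
    · rw [e1, e2]; exact hadj'
    · rw [e1, e2]; exact hadj'.symm
  have hdm : (g, o) ∈ triBdryDarts D.verts := mem_triBdryDarts.2 ⟨hg, ho, hadj⟩
  -- the frame-A₀ statement, for any 3-marked domain with the same sites
  have main : ∀ (D' : TriMarkedDomain 3), D'.verts = D.verts → (g, o) ∈ D'.stretch 0 → AllSides D' v →
      Hobs D' v i 1 = (triSitePercolation half).real (arcToCrossingA D' 0 g o) ∧
        Hobs D' v i 0 = (triSitePercolation half).real (arcFromCrossingA D' 0 g o) := by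
    intro D' hD' hd' hv'
    have hdm' : (g, o) ∈ triBdryDarts D'.verts := by rw [hD']; exact hdm
    have hst' := stretchIdx₃_of_mem_stretch D' hd'
    rw [arcToCrossingA_zero hdm', arcFromCrossingA_zero hdm' hst']
    exact ⟨hobs_one_eq_prob (hD' ▸ hg) (hD' ▸ ho) hadj hst' hv' he, hobs_zero_eq_prob_open (hD' ▸ hg) (hD' ▸ ho) hadj hst' hv' he⟩
  have h3 : ∀ a' : Fin 3, a' = 0 ∨ a' = 1 ∨ a' = 2 := by decide
  rcases h3 a with rfl | rfl | rfl
  · exact main D rfl hd hv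
  · have hd' : (g, o) ∈ D.rotate.stretch 0 := by rw [rotate_stretch]; exact hd
    have h := main D.rotate rfl hd' ((rotate_allSides D v).2 hv)
    rw [rotate_hobs, rotate_hobs, rotate_arcToCrossingA, rotate_arcFromCrossingA] at h
    exact h
  · have hd' : (g, o) ∈ D.rotate.rotate.stretch 0 := by rw [rotate_stretch, rotate_stretch]; exact hd
    have h := main D.rotate.rotate rfl hd' ((rotate_allSides D.rotate v).2 ((rotate_allSides D v).2 hv))
    rw [rotate_hobs, rotate_hobs, rotate_hobs, rotate_hobs, rotate_arcToCrossingA, rotate_arcToCrossingA, rotate_arcFromCrossingA,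
      rotate_arcFromCrossingA] at h
    exact h

/-- ★★★ **KHRISTOFOROV–SMIRNOV eq. (4) VERBATIM, every boundary arc**: for `z` on `A_a`,
`F(z) = P^perc[∂_{z y_{a+1}}Ω ↔ A_{a+2}]·τ^a + P^perc[∂_{y_a z}Ω ↔ A_{a+1}]·τ^{a+1}`, the two probabilities summing to `1` — in the printed
indexing (`∂_jΩ = A_a`, `u_{j+1} = y_a`, `u_{j−1} = y_{a+1}`) the display `F(z) = P[∂_{j+1,z} ↔ ∂_{j−1,j}]·τ^{j−1} + P[∂_{j,j+1} ↔ ∂_{z,j−1}]·τ^{j+1}`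
up to the global rotation of the corner labels. [cite: KhristoforovSmirnov2021, §2 eq. (4) (arXiv v1 p. 5)] -/
theorem fobs_eq_crossingProbs_of_mem_stretch {v : HexVertex} (hv : AllSides D v) {i : Fin 3} {g o : Site 2} (he : side v i = s(g, o))
    (hg : g ∈ D.verts) (ho : o ∉ D.verts) {a : Fin 3} (hd : (g, o) ∈ D.stretch a) :
    Fobs D v i = tau ^ (a : ℕ) * ((triSitePercolation half).real (arcFromCrossingA D a g o) : ℂ) +
        tau ^ ((a : ℕ) + 1) * ((triSitePercolation half).real (arcToCrossingA D a g o) : ℂ) ∧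
      (triSitePercolation half).real (arcFromCrossingA D a g o) + (triSitePercolation half).real (arcToCrossingA D a g o) = 1 := by
  obtain ⟨h1, h0⟩ := hobs_eq_prob_of_mem_stretch hv he hg ho hd
  have hsum := hobs_add_hobs_succ_eq_one D hv he hg ho hd
  have hz := hobs_opposite_eq_zero D hv he hg ho hd
  refine ⟨?_, by rw [← h0, ← h1]; exact hsum⟩
  rw [← h0, ← h1]
  unfold Fobs
  rw [Fin.sum_univ_three]
  have h3 : ∀ a' : Fin 3, a' = 0 ∨ a' = 1 ∨ a' = 2 := by decide
  have htau3 : tau ^ 3 = 1 := by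
    have hsum : 1 + tau + tau ^ 2 = 0 := by
      have hprim : IsPrimitiveRoot tau 3 := by
        have h := Complex.isPrimitiveRoot_exp 3 (by norm_num)
        unfold tau
        convert h using 2
        push_cast
        ring
      have h := hprim.geom_sum_eq_zero (by norm_num : 1 < 3)
      simp only [Finset.sum_range_succ, Finset.sum_range_zero, pow_zero, pow_one, zero_add] at h
      linear_combination h
    linear_combination (tau - 1) * hsum
  rcases h3 a with rfl | rfl | rfl
  · have e : (0 : Fin 3) + 2 = 2 := rfl
    rw [e] at hz
    simp only [Fin.val_zero, Fin.val_one, Fin.val_two, hz]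
    push_cast
    ring
  · have e : (1 : Fin 3) + 2 = 0 := rfl
    have e1 : (1 : Fin 3) + 1 = 2 := rfl
    rw [e] at hz; rw [e1] at h1 ⊢
    simp only [Fin.val_zero, Fin.val_one, Fin.val_two, hz]
    push_cast
    ring
  · have e : (2 : Fin 3) + 2 = 1 := rfl
    have e1 : (2 : Fin 3) + 1 = 0 := rfl
    rw [e] at hz; rw [e1] at h1 ⊢
    simp only [Fin.val_zero, Fin.val_one, Fin.val_two, hz]
    push_cast
    linear_combination (-(Hobs D v i 0 : ℂ)) * htau3

/-! ### edition 2: every arc, EVERY mid-edge — no hypothesis on the face at which `z` is read -/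

/-- Auxiliary. [folklore] -/
private theorem fin3_add_one_add_one_a (j : Fin 3) : j + 1 + 1 = j + 2 := by rw [add_assoc]; rfl

/-- the two endpoints of a side are adjacent, read through `side v i = s(g, o)`. [folklore] -/
private theorem adj_of_side_eq {v : HexVertex} {i : Fin 3} {g o : Site 2} (he : side v i = s(g, o)) : triGraph.Adj g o := by
  have h12 : triGraph.Adj (faceVertex v (i + 1)) (faceVertex v (i + 2)) := by
    have := TriMarkedDomain.adj_faceVertex_succ v (i + 1); rwa [fin3_add_one_add_one_a] at this
  have he' := he
  unfold side at he'
  rcases Sym2.eq_iff.1 he' with ⟨e1, e2⟩ | ⟨e1, e2⟩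
  · rw [← e1, ← e2]; exact h12
  · rw [← e1, ← e2]; exact h12.symm

/-- ★★★ **KhS eq. (4), PERCOLATION SIDE, EVERY ARC, EVERY MID-EDGE**: for `z` a boundary mid-edge of the arc `A_a` (dart `(g, o) ∈ D.stretch a`)
read at ANY face `v` of its bond: `H_{a+1}(z) = P_{1/2}[∂_{y_a z}Ω ↔ A_{a+1}]`, `H_a(z) = P_{1/2}[∂_{z y_{a+1}}Ω ↔ A_{a+2}]`, `H_{a+2}(z) = 0`,
`H_a(z) + H_{a+1}(z) = 1`. [cite: KhristoforovSmirnov2021, §2 eq. (4) (arXiv v1 p. 5) with §1.2 Lemma 2 (pp. 2–3)] -/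
theorem hobs_eq_prob_of_mem_stretch' {v : HexVertex} {i : Fin 3} {g o : Site 2} (he : side v i = s(g, o))
    (hg : g ∈ D.verts) (ho : o ∉ D.verts) {a : Fin 3} (hd : (g, o) ∈ D.stretch a) :
    Hobs D v i (a + 1) = (triSitePercolation half).real (arcToCrossingA D a g o) ∧
      Hobs D v i a = (triSitePercolation half).real (arcFromCrossingA D a g o) ∧
      Hobs D v i (a + 2) = 0 ∧ Hobs D v i a + Hobs D v i (a + 1) = 1 := by
  have hadj : triGraph.Adj g o := adj_of_side_eq he
  have hdm : (g, o) ∈ triBdryDarts D.verts := mem_triBdryDarts.2 ⟨hg, ho, hadj⟩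
  -- the frame-A₀ statement, for any 3-marked domain with the same sites
  have main : ∀ (D' : TriMarkedDomain 3), D'.verts = D.verts → (g, o) ∈ D'.stretch 0 →
      Hobs D' v i 1 = (triSitePercolation half).real (arcToCrossingA D' 0 g o) ∧
        Hobs D' v i 0 = (triSitePercolation half).real (arcFromCrossingA D' 0 g o) ∧
        Hobs D' v i 2 = 0 ∧ Hobs D' v i 0 + Hobs D' v i 1 = 1 := by
    intro D' hD' hd'
    have hdm' : (g, o) ∈ triBdryDarts D'.verts := by rw [hD']; exact hdm
    have hst' := stretchIdx₃_of_mem_stretch D' hd'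
    rw [arcToCrossingA_zero hdm', arcFromCrossingA_zero hdm' hst']
    exact ⟨hobs_one_eq_prob' (hD' ▸ hg) (hD' ▸ ho) hadj hst' he, hobs_zero_eq_prob_open' (hD' ▸ hg) (hD' ▸ ho) hadj hst' he,
      hobs_two_eq_zero' (hD' ▸ hg) (hD' ▸ ho) hadj hst' he, hobs_zero_add_hobs_one' (hD' ▸ hg) (hD' ▸ ho) hadj hst' he⟩
  have h3 : ∀ a' : Fin 3, a' = 0 ∨ a' = 1 ∨ a' = 2 := by decide
  rcases h3 a with rfl | rfl | rfl
  · exact main D rfl hd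
  · have hd' : (g, o) ∈ D.rotate.stretch 0 := by rw [rotate_stretch]; exact hd
    have h := main D.rotate rfl hd'
    simp only [rotate_hobs, rotate_arcToCrossingA, rotate_arcFromCrossingA] at h
    exact h
  · have hd' : (g, o) ∈ D.rotate.rotate.stretch 0 := by rw [rotate_stretch, rotate_stretch]; exact hd
    have h := main D.rotate.rotate rfl hd'
    simp only [rotate_hobs, rotate_arcToCrossingA, rotate_arcFromCrossingA] at h
    exact h

/-- ★★★ **KHRISTOFOROV–SMIRNOV eq. (4) VERBATIM, every boundary arc, EVERY mid-edge**: for `z` on `A_a`, read at any face of its bond,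
`F(z) = P^perc[∂_{z y_{a+1}}Ω ↔ A_{a+2}]·τ^a + P^perc[∂_{y_a z}Ω ↔ A_{a+1}]·τ^{a+1}`, the two probabilities summing to `1`.
[cite: KhristoforovSmirnov2021, §2 eq. (4) (arXiv v1 p. 5)] -/
theorem fobs_eq_crossingProbs_of_mem_stretch' {v : HexVertex} {i : Fin 3} {g o : Site 2} (he : side v i = s(g, o))
    (hg : g ∈ D.verts) (ho : o ∉ D.verts) {a : Fin 3} (hd : (g, o) ∈ D.stretch a) :
    Fobs D v i = tau ^ (a : ℕ) * ((triSitePercolation half).real (arcFromCrossingA D a g o) : ℂ) +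
        tau ^ ((a : ℕ) + 1) * ((triSitePercolation half).real (arcToCrossingA D a g o) : ℂ) ∧
      (triSitePercolation half).real (arcFromCrossingA D a g o) + (triSitePercolation half).real (arcToCrossingA D a g o) = 1 := by
  obtain ⟨h1, h0, hz, hsum⟩ := hobs_eq_prob_of_mem_stretch' he hg ho hd
  refine ⟨?_, by rw [← h0, ← h1]; exact hsum⟩
  rw [← h0, ← h1]
  unfold Fobs
  rw [Fin.sum_univ_three]
  have h3 : ∀ a' : Fin 3, a' = 0 ∨ a' = 1 ∨ a' = 2 := by decide
  have htau3 : tau ^ 3 = 1 := by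
    have hsum' : 1 + tau + tau ^ 2 = 0 := by
      have hprim : IsPrimitiveRoot tau 3 := by
        have h := Complex.isPrimitiveRoot_exp 3 (by norm_num)
        unfold tau
        convert h using 2
        push_cast
        ring
      have h := hprim.geom_sum_eq_zero (by norm_num : 1 < 3)
      simp only [Finset.sum_range_succ, Finset.sum_range_zero, pow_zero, pow_one, zero_add] at h
      linear_combination h
    linear_combination (tau - 1) * hsum'
  rcases h3 a with rfl | rfl | rfl
  · have e : (0 : Fin 3) + 2 = 2 := rfl
    rw [e] at hz
    simp only [Fin.val_zero, Fin.val_one, Fin.val_two, hz]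
    push_cast
    ring
  · have e : (1 : Fin 3) + 2 = 0 := rfl
    have e1 : (1 : Fin 3) + 1 = 2 := rfl
    rw [e] at hz; rw [e1] at h1 ⊢
    simp only [Fin.val_zero, Fin.val_one, Fin.val_two, hz]
    push_cast
    ring
  · have e : (2 : Fin 3) + 2 = 1 := rfl
    have e1 : (2 : Fin 3) + 1 = 0 := rfl
    rw [e] at hz; rw [e1] at h1 ⊢
    simp only [Fin.val_zero, Fin.val_one, Fin.val_two, hz]
    push_cast
    linear_combination (-(Hobs D v i 0 : ℂ)) * htau3

end ArcsP

end Literature.Probability.Percolation.MarkedLoops
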